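import Literature.NumberTheory.LFunctions.ConreyIwaniec2002SigmaLSeries
import Literature.NumberTheory.LFunctions.ConreyIwaniec2002CircleMethodDefs
import Literature.NumberTheory.LFunctions.ConreyIwaniec2002GenusCharByValues
import Literature.NumberTheory.QuadraticFields.GenusCharactersExhaust
import HarnessLib

/-!
# Conrey–Iwaniec (2002) §4, (4.21), (4.27)–(4.34) with §2 (2.19): the main-term coefficients
# `σ(h)` of `θ(z;ψ)` satisfy `IsCISigma` — the registered stub S3e `stub_sigma_genus`

B. Conrey, H. Iwaniec, *Spacing of zeros of Hecke L-functions and the class number problem*,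
Acta Arith. 103 (2002) 259–312 [held text `paper:arxiv-math_0111012`, p0006 (2.19), p0012–p0013
(4.21), (4.27)–(4.34), p0015 (6.20)–(6.26)]. Closing file (4/4) of the S3e toolkit of the line
`theta-circle-method` (cell `landau-siegel/ls-inputs`, SKELETON S3 v4 cafb5c09c3515d2c :229 = v6);
theorem-only.

THE STUB. `σ = ciSigma p`, `p = voronoiMainCoeff q ℓ ψ` (`p(c) = √s·ℓ/c` if `ψ` is the genus
character of `s = (c,q)` BY VALUES, `IsGenusCharFor ψ s`, else `0`; `ℓ = L(1,χ)`), and the claim is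
`IsCISigma q ℓ σ`: `|σ(h)| ≤ 2ℓ²σ₋₁(h)` and `σ = 0 ∨ Σ_h σ(h)h^{-s} = κℓ²(ε₁F_{v,w} + ε₂F_{w,v})ζ(s)ζ(s+1)`.

THE GENUS STEP (2.19): the divisors `s ∣ q` with `IsGenusCharFor ψ s` are EITHER none (then
`p = 0`, `σ = 0`: the cusp-form case of Theorem 4.3, "`Z = 0`") OR, if `v` is one of them, contained
in `{v, q/v}` (`isGenusCharFor_dichotomy`: two moduli `s, s'` of the same `ψ` have
`ψ_{S} = ψ_{S'}` for the tree's products of prime genus characters (`Quadratic.genusCharProd`,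
Cox Thm. 3.15; uniqueness by values is P64-w6's `eq_of_isGenusCharFor`), and
`Quadratic.eq_of_genusCharProd_eq` forces `S = S'` unless `S ∆ S' = ` all primes of `q`, i.e.
`s' = q/s`). We do NOT need (and do not prove) that `q/v` is then also a genus modulus: with
`b = [IsGenusCharFor ψ (q/v)] ∈ {0,1}`,
`p(c)² = [(c,q)=v]·vℓ²/c² + b·[(c,q)=q/v]·(q/v)ℓ²/c²` (`voronoiMainCoeff_sq_eq`), hence
`σ(h) = ℓ²(v·Σ_{(c,q)=v} r_c(h)c⁻² + b·w·Σ_{(c,q)=w} r_c(h)c⁻²)` for `h ≥ 1` (`ciSigma_eq`, (4.27)), and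
`isCISigma_of_eq_rcSum` (file 3/4: (4.28)–(4.34), `κ = ζ_q(2)/ζ(2) ∈ [0,1]`, `ε₁ = μ(v)`,
`ε₂ = bμ(w)`) closes the stub:

* **`sigma_genus`** — the registered S3e statement, TEXT VERBATIM (`stub_sigma_genus := sigma_genus`).

«The programme SEARCHES and TYPES; no claim about Landau–Siegel zeros, Theorems 1–2 of
arXiv:2211.02515 or a repaired Margin232 until a kernel theorem says so.» Nothing here proves
Proposition 6.4 or anything about `L(1,χ)`.
-/

noncomputable section

open scoped NumberField ArithmeticFunction.Moebius
open Complex Finset ArithmeticFunction Literature.NumberTheory.Sieve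

namespace Literature.NumberTheory.LFunctions

namespace ConreyIwaniec2002

open NumberField Literature.NumberTheory.LFunctions.NumberField
open Literature.NumberTheory.QuadraticFields Literature.NumberTheory.EllipticCurves
open IsDedekindDomain SigmaGenus

namespace SigmaGenus

variable {K : Type*} [Field K] [NumberField K]

/-! ### The genus characters by values and the dichotomy of their moduli -/

/-- The tree's product of prime genus characters `ψ_S`, `S = primeFactors s`, IS the genus character
of the squarefree divisor `s` by values: `ψ_S([𝔭]) = (N𝔭/s)` off `s` ((2.19); values by
`Quadratic.genusCharProd_mk0_eq`, `∏_{p∣s} p = s`). [cite: ConreyIwaniec2002, §2 (2.19)]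
[cite: Cox2013, §3.B Thm. 3.15] -/
theorem isGenusCharFor_genusCharProd (hK : IsImaginaryQuadratic K) {s : ℕ} (hs : Squarefree s)
    (hS : ∀ p ∈ s.primeFactors, p.Prime ∧ p ≠ 2 ∧ (p : ℤ) ∣ NumberField.discr K) :
    IsGenusCharFor (Quadratic.genusCharProd hK s.primeFactors hS) s := by
  intro v hv
  have hmod : Quadratic.genusModulus s.primeFactors = s := Nat.prod_primeFactors_of_squarefree hs
  have hcop : ∀ p ∈ s.primeFactors, ¬ (p : ℤ) ∣ Ideal.absNorm v.asIdeal := by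
    intro p hp hdvd
    have hpp : p.Prime := Nat.prime_of_mem_primeFactors hp
    have hps : p ∣ s := Nat.dvd_of_mem_primeFactors hp
    have h1 : p ∣ Nat.gcd (Ideal.absNorm v.asIdeal) s :=
      Nat.dvd_gcd (Int.natCast_dvd_natCast.mp hdvd) hps
    rw [hv] at h1
    exact hpp.ne_one (Nat.dvd_one.mp h1)
  rw [classGroupCharPrimeValue_apply,
    Quadratic.genusCharProd_mk0_eq (mem_nonZeroDivisors_of_ne_zero v.ne_bot) hcop, hmod]

/-- For finsets `A, B ⊆ P` with `A ∆ B = P`: `B = P \ A`. [folklore] -/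
private theorem eq_sdiff_of_symmDiff_eq {A B P : Finset ℕ} (hA : A ⊆ P) (hB : B ⊆ P)
    (h : symmDiff A B = P) : B = P \ A := by
  ext p
  rw [Finset.mem_sdiff]
  constructor
  · intro hpB
    refine ⟨hB hpB, fun hpA ↦ ?_⟩
    have : p ∉ symmDiff A B := by
      rw [Finset.mem_symmDiff]; tauto
    exact this (h.symm ▸ hA hpA)
  · rintro ⟨hpP, hpA⟩
    have : p ∈ symmDiff A B := h.symm ▸ hpP
    rw [Finset.mem_symmDiff] at this
    tauto

/-- A product over a proper sub-finset of primes is smaller. [folklore] -/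
private theorem prod_lt_of_ssubset {T P : Finset ℕ} (hP : ∀ p ∈ P, p.Prime) (hT : T ⊆ P) (hne : T ≠ P) :
    ∏ p ∈ T, p < ∏ p ∈ P, p := by
  classical
  have hsd : (P \ T).Nonempty := by
    rw [Finset.sdiff_nonempty]; intro h
    exact hne (Finset.Subset.antisymm hT h)
  obtain ⟨p₀, hp₀⟩ := hsd
  have hTpos : 0 < ∏ p ∈ T, p := Finset.prod_pos fun p hp ↦ (hP p (hT hp)).pos
  have h2 : 2 ≤ ∏ p ∈ P \ T, p := by
    have hdvd : p₀ ∣ ∏ p ∈ P \ T, p := Finset.dvd_prod_of_mem _ hp₀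
    have hpos : 0 < ∏ p ∈ P \ T, p :=
      Finset.prod_pos fun p hp ↦ (hP p (Finset.mem_sdiff.mp hp).1).pos
    exact le_trans (hP p₀ (Finset.mem_sdiff.mp hp₀).1).two_le (Nat.le_of_dvd hpos hdvd)
  rw [← Finset.prod_sdiff hT]
  nlinarith

/-- **Dichotomy of the genus moduli** ((2.19): "`χ_vχ_w = χ_q` … given uniquely"): for `K` with
`d_K = −q`, `q` odd squarefree, and two divisors `s, s' ∣ q` that are both genus moduli of the same
`ψ` by values, `s' = s` or `s' = q/s`. Proof: `ψ = ψ_S = ψ_{S'}` (`eq_of_isGenusCharFor`,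
`isGenusCharFor_genusCharProd`), and `Quadratic.eq_of_genusCharProd_eq` gives `S = S'` unless
`∏_{S ∆ S'} p = q`, i.e. `S' = primes(q) ∖ S`. [cite: ConreyIwaniec2002, §2 (2.19)] [cite: Cox2013, §3.B Thm. 3.15] -/
theorem isGenusCharFor_dichotomy (hK : IsImaginaryQuadratic K) {q : ℕ} (hq : Squarefree q)
    (hqodd : Odd q) (hdisc : NumberField.discr K = -(q : ℤ)) {ψ : ClassGroup (𝓞 K) →* ℂˣ}
    {s s' : ℕ} (hs : s ∣ q) (hs' : s' ∣ q) (h : IsGenusCharFor ψ s) (h' : IsGenusCharFor ψ s') :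
    s' = s ∨ s' = q / s := by
  classical
  have hq0 : q ≠ 0 := hq.ne_zero
  have hnat : (NumberField.discr K).natAbs = q := by rw [hdisc]; simp
  have hP : ∀ p ∈ q.primeFactors, p.Prime ∧ p ≠ 2 ∧ (p : ℤ) ∣ NumberField.discr K := by
    intro p hp
    have hpp : p.Prime := Nat.prime_of_mem_primeFactors hp
    have hpq : p ∣ q := Nat.dvd_of_mem_primeFactors hp
    refine ⟨hpp, ?_, ?_⟩
    · rintro rfl
      exact (Nat.not_even_iff_odd.mpr hqodd) (even_iff_two_dvd.mpr hpq)
    · rw [hdisc]; exact (dvd_neg).mpr (Int.natCast_dvd_natCast.mpr hpq)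
  have hSub : s.primeFactors ⊆ q.primeFactors := Nat.primeFactors_mono hs hq0
  have hSub' : s'.primeFactors ⊆ q.primeFactors := Nat.primeFactors_mono hs' hq0
  have hS : ∀ p ∈ s.primeFactors, p.Prime ∧ p ≠ 2 ∧ (p : ℤ) ∣ NumberField.discr K :=
    fun p hp ↦ hP p (hSub hp)
  have hS' : ∀ p ∈ s'.primeFactors, p.Prime ∧ p ≠ 2 ∧ (p : ℤ) ∣ NumberField.discr K :=
    fun p hp ↦ hP p (hSub' hp)
  have hssq : Squarefree s := hq.squarefree_of_dvd hs
  have hssq' : Squarefree s' := hq.squarefree_of_dvd hs'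
  have e1 : ψ = Quadratic.genusCharProd hK s.primeFactors hS :=
    eq_of_isGenusCharFor hssq.ne_zero h (isGenusCharFor_genusCharProd hK hssq hS)
  have e2 : ψ = Quadratic.genusCharProd hK s'.primeFactors hS' :=
    eq_of_isGenusCharFor hssq'.ne_zero h' (isGenusCharFor_genusCharProd hK hssq' hS')
  have heq : Quadratic.genusCharProd hK s.primeFactors hS = Quadratic.genusCharProd hK s'.primeFactors hS' :=
    e1.symm.trans e2
  have hsub : symmDiff s.primeFactors s'.primeFactors ⊆ q.primeFactors := by
    intro p hp
    rcases Finset.mem_symmDiff.mp hp with ⟨h1, -⟩ | ⟨h1, -⟩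
    · exact hSub h1
    · exact hSub' h1
  by_cases hU : symmDiff s.primeFactors s'.primeFactors = q.primeFactors
  · right
    have hB := eq_sdiff_of_symmDiff_eq hSub hSub' hU
    have hprod : s' * s = q := by
      rw [← Nat.prod_primeFactors_of_squarefree hssq', ← Nat.prod_primeFactors_of_squarefree hssq,
        ← Nat.prod_primeFactors_of_squarefree hq, hB, Finset.prod_sdiff hSub]
    exact Nat.eq_div_of_mul_eq_left hssq.ne_zero hprod
  · left
    have hlt : Quadratic.genusModulus (symmDiff s.primeFactors s'.primeFactors) <
        (NumberField.discr K).natAbs := by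
      rw [hnat, Quadratic.genusModulus, ← Nat.prod_primeFactors_of_squarefree hq]
      exact prod_lt_of_ssubset (fun p hp ↦ Nat.prime_of_mem_primeFactors hp) hsub hU
    have hST := Quadratic.eq_of_genusCharProd_eq hK hS hS' heq hlt
    rw [← Nat.prod_primeFactors_of_squarefree hssq', ← Nat.prod_primeFactors_of_squarefree hssq, hST]

/-! ### The main-term coefficients `p(c)` of `θ(z;ψ)` and `σ = ciSigma p` -/

/-- **`p(c)²` for `θ(z;ψ)`** ((4.21)): if `v ∣ q` is a genus modulus of `ψ`, `w = q/v`, and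
`b = [w is one too] ∈ {0,1}`, then for every `c`,
`voronoiMainCoeff q ℓ ψ c ² = [(c,q)=v]·vℓ²/c² + b·[(c,q)=w]·wℓ²/c²` (the only genus moduli are `v`
and possibly `w`, `isGenusCharFor_dichotomy`; `v ≠ w` as `q > 1` is squarefree).
[cite: ConreyIwaniec2002, §4 (4.21), (4.27)] -/
theorem voronoiMainCoeff_sq_eq (hK : IsImaginaryQuadratic K) {q : ℕ} (hq : Squarefree q)
    (hqodd : Odd q) (hq1 : 1 < q) (hdisc : NumberField.discr K = -(q : ℤ))
    {ψ : ClassGroup (𝓞 K) →* ℂˣ} {v : ℕ} (hv : v ∣ q) (hgen : IsGenusCharFor ψ v) {b : ℝ}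
    (hb1 : IsGenusCharFor ψ (q / v) → b = 1) (hb0 : ¬ IsGenusCharFor ψ (q / v) → b = 0)
    (ℓ : ℝ) (c : ℕ) :
    voronoiMainCoeff q ℓ ψ c ^ 2 =
      (if Nat.gcd c q = v then (v : ℝ) * ℓ ^ 2 / (c : ℝ) ^ 2 else 0) +
        b * (if Nat.gcd c q = q / v then ((q / v : ℕ) : ℝ) * ℓ ^ 2 / (c : ℝ) ^ 2 else 0) := by
  classical
  have hq0 : q ≠ 0 := hq.ne_zero
  have hvw' : v * (q / v) = q := Nat.mul_div_cancel' hv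
  have hvw : v ≠ q / v := by
    intro hvw
    rw [← hvw] at hvw'
    have hcop : v.Coprime v := Nat.coprime_of_squarefree_mul (hvw'.symm ▸ hq)
    have hv1 : v = 1 := (Nat.coprime_self v).mp hcop
    rw [hv1, mul_one] at hvw'
    omega
  have hgq : Nat.gcd c q ∣ q := Nat.gcd_dvd_right c q
  by_cases hg : IsGenusCharFor ψ (Nat.gcd c q)
  · rw [voronoiMainCoeff,
      Set.indicator_of_mem (show c ∈ {c : ℕ | IsGenusCharFor ψ (Nat.gcd c q)} from hg)]
    rcases isGenusCharFor_dichotomy hK hq hqodd hdisc hv hgq hgen hg with hcv | hcw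
    · -- `(c,q) = v`
      rw [if_pos hcv, if_neg (by rw [hcv]; exact hvw), mul_zero, add_zero, hcv, div_pow, mul_pow,
        Real.sq_sqrt (Nat.cast_nonneg v)]
    · -- `(c,q) = q/v`
      have hbw : IsGenusCharFor ψ (q / v) := by rw [← hcw]; exact hg
      rw [if_neg (by rw [hcw]; exact fun h ↦ hvw h.symm), hb1 hbw, if_pos hcw, zero_add, one_mul,
        hcw, div_pow, mul_pow, Real.sq_sqrt (Nat.cast_nonneg (q / v))]
  · rw [voronoiMainCoeff,
      Set.indicator_of_notMem (show c ∉ {c : ℕ | IsGenusCharFor ψ (Nat.gcd c q)} from hg)]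
    have h1 : ¬ Nat.gcd c q = v := fun hcv ↦ hg (hcv ▸ hgen)
    rw [if_neg h1]
    by_cases hbw : IsGenusCharFor ψ (q / v)
    · have h2 : ¬ Nat.gcd c q = q / v := fun hcw ↦ hg (hcw ▸ hbw)
      rw [if_neg h2]; simp
    · rw [hb0 hbw]; simp

/-- The real part of the Ramanujan sum is Kluyver's integer `Σ_{d∣(c,h)} dμ(c/d)`. [folklore] -/
private theorem ramanujanSum_re (c h : ℕ) :
    (ramanujanSum c h).re = (ramanujanDivisorSum h c : ℝ) := by
  rw [ramanujanSum_eq_ramanujanDivisorSum, Int.natAbs_natCast, Complex.intCast_re]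

/-- **`σ(h)` for `θ(z;ψ)`** ((4.27)): with `v`, `w = q/v`, `b` as in `voronoiMainCoeff_sq_eq` and
`h ≥ 1`, `ciSigma p h = Σ_c r_c(h) p(c)² = ℓ²(v·Σ_{(c,q)=v} r_c(h)c⁻² + b·w·Σ_{(c,q)=w} r_c(h)c⁻²)`.
[cite: ConreyIwaniec2002, §4 (4.16), (4.27)] -/
theorem ciSigma_eq (hK : IsImaginaryQuadratic K) {q : ℕ} (hq : Squarefree q) (hqodd : Odd q)
    (hq1 : 1 < q) (hdisc : NumberField.discr K = -(q : ℤ)) {ψ : ClassGroup (𝓞 K) →* ℂˣ}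
    {v : ℕ} (hv : v ∣ q) (hgen : IsGenusCharFor ψ v) {b : ℝ}
    (hb1 : IsGenusCharFor ψ (q / v) → b = 1) (hb0 : ¬ IsGenusCharFor ψ (q / v) → b = 0)
    (ℓ : ℝ) {h : ℕ} (hh : h ≠ 0) :
    ciSigma (voronoiMainCoeff q ℓ ψ) h =
      ℓ ^ 2 * (1 * ((v : ℝ) * rcSum q v h) + b * (((q / v : ℕ) : ℝ) * rcSum q (q / v) h)) := by
  set w := q / v with hw
  -- the summand `c ↦ r_c(h) p(c)²` as a combination of the two `rcSum` summands
  set F : ℕ → ℝ := fun c ↦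
    (v : ℝ) * ℓ ^ 2 * (if Nat.gcd c q = v then (ramanujanDivisorSum h c : ℝ) / (c : ℝ) ^ 2 else 0) +
      b * ((w : ℝ) * ℓ ^ 2) *
        (if Nat.gcd c q = w then (ramanujanDivisorSum h c : ℝ) / (c : ℝ) ^ 2 else 0) with hF
  have hterm : ∀ c : ℕ, (ramanujanSum c h).re * voronoiMainCoeff q ℓ ψ c ^ 2 = F c := by
    intro c
    rw [ramanujanSum_re, voronoiMainCoeff_sq_eq hK hq hqodd hq1 hdisc hv hgen hb1 hb0 ℓ c, hF]
    simp only
    split_ifs <;> ring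
  have hF0 : F 0 = 0 := by simp [hF]
  have hsumF : Summable F :=
    ((summable_rcSum_term q v hh).mul_left _).add ((summable_rcSum_term q w hh).mul_left _)
  have htsum : ∑' c : ℕ, F c =
      (v : ℝ) * ℓ ^ 2 * rcSum q v h + b * ((w : ℝ) * ℓ ^ 2) * rcSum q w h := by
    rw [hF, ((summable_rcSum_term q v hh).mul_left _).tsum_add
      ((summable_rcSum_term q w hh).mul_left _), tsum_mul_left, tsum_mul_left]
    rfl
  unfold ciSigma
  rw [tsum_congr (fun c ↦ hterm (c + 1)), ← sub_eq_zero]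
  rw [hsumF.tsum_eq_zero_add, hF0, zero_add] at htsum
  rw [htsum]
  ring

end SigmaGenus

/-! ### The registered stub S3e -/

/-- **S3e `stub_sigma_genus` — (4.27)–(4.34) with genus theory (2.19): the main-term coefficients of
`θ(z;ψ)` satisfy `IsCISigma`** (statement VERBATIM the registered stub of SKELETON S3 v4 :229):
`σ(h) = Σ_c r_c(h)p(c)²` with `p` of (4.21) is `0` unless some divisor of `q` is a genus modulus of
`ψ`; if `v` is one, the genus moduli lie in `{v, w}`, `vw = q` (`isGenusCharFor_dichotomy`, Cox
Thm. 3.15 via the tree's `Quadratic.eq_of_genusCharProd_eq`), so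
`σ(h) = ℓ²{vΣ_{(c,q)=v}r_c(h)c⁻² + b·wΣ_{(c,q)=w}r_c(h)c⁻²}` (4.27) (`b ∈ {0,1}`), whence
`|σ(h)| ≤ 2ℓ²σ₋₁(h)` (4.32) and `Σ_hσ(h)h^{-s} = κℓ²(μ(v)F_{v,w} + bμ(w)F_{w,v})ζ(s)ζ(s+1)` (4.34)
with `κ = ζ_q(2)/ζ(2) ∈ [0,1]` (`SigmaGenus.isCISigma_of_eq_rcSum`).
[cite: ConreyIwaniec2002, §4 (4.27)–(4.34); §2 (2.19); §6 (6.20)–(6.24)] -/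
theorem sigma_genus :
    ∀ (q : ℕ) [NeZero q], 4 < q → Odd q → ∀ χ : DirichletCharacter ℂ q,
      χ.IsPrimitive → χ.IsQuadratic → χ.Odd →
        ∀ (K : Type) [Field K] [NumberField K],
          Module.finrank ℚ K = 2 → NumberField.discr K = -(q : ℤ) →
            ∀ (ψ : ClassGroup (𝓞 K) →* ℂˣ),
              IsCISigma q ‖χ.LFunction 1‖
                (ciSigma (voronoiMainCoeff q ‖χ.LFunction 1‖ ψ)) := by
  intro q _ hq4 hodd χ hprim hquad _ K _ _ h2 hdisc ψ
  classical
  -- `q` is squarefree (odd with a primitive real character) and `K` is imaginary quadratic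
  have hsqf : Squarefree q := by
    rw [Nat.squarefree_iff_prime_squarefree]
    intro p hp hpp
    have hp2 : p ≠ 2 := by
      rintro rfl
      exact (Nat.not_even_iff_odd.mpr hodd) (even_iff_two_dvd.mpr ((dvd_mul_right 2 2).trans hpp))
    exact Literature.Barriers.Parity.SiegelCorr.not_odd_prime_sq_dvd χ hprim hquad hp hp2
      (by rw [pow_two]; exact hpp)
  have hK : IsImaginaryQuadratic K :=
    isImaginaryQuadratic_iff_discr_neg.2 ⟨h2, by rw [hdisc]; omega⟩
  have hq1 : 1 < q := by omega
  set ℓ : ℝ := ‖χ.LFunction 1‖ with hℓ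
  by_cases hex : ∃ v : ℕ, v ∣ q ∧ IsGenusCharFor ψ v
  · -- a genus modulus `v`; the others lie in `{v, q/v}`
    obtain ⟨v, hv, hgen⟩ := hex
    set b : ℝ := if IsGenusCharFor ψ (q / v) then (1 : ℝ) else 0 with hb
    have hb1 : IsGenusCharFor ψ (q / v) → b = 1 := fun h ↦ by rw [hb, if_pos h]
    have hb0 : ¬ IsGenusCharFor ψ (q / v) → b = 0 := fun h ↦ by rw [hb, if_neg h]
    have hb' : |b| ≤ 1 := by
      rw [hb]; split_ifs <;> simp
    exact SigmaGenus.isCISigma_of_eq_rcSum hsqf hodd hv ℓ 1 b (by simp) hb' fun h hh ↦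
      SigmaGenus.ciSigma_eq hK hsqf hodd hq1 hdisc hv hgen hb1 hb0 ℓ hh
  · -- no genus modulus: `p = 0`, `σ = 0` (the cusp-form case)
    simp only [not_exists, not_and] at hex
    have hp : voronoiMainCoeff q ℓ ψ = fun _ ↦ 0 := by
      funext c
      exact Set.indicator_of_notMem
        (show c ∉ {c : ℕ | IsGenusCharFor ψ (Nat.gcd c q)} from hex _ (Nat.gcd_dvd_right c q)) _
    have hσ : ciSigma (voronoiMainCoeff q ℓ ψ) = 0 := by
      funext h
      simp [ciSigma, hp]
    rw [hσ]
    refine ⟨fun h _ ↦ ?_, Or.inl rfl⟩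
    simp only [Pi.zero_apply, abs_zero]
    exact mul_nonneg (mul_nonneg zero_le_two (sq_nonneg _))
      (Finset.sum_nonneg fun d _ ↦ by positivity)

end ConreyIwaniec2002

end Literature.NumberTheory.LFunctions

end
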